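import Mathlib
import Summits.ValiantsHypothesis.ValiantsHypothesis.Theorems.LacunarySymmetroidMatrixDescartesDominantMiddle
import Summits.ValiantsHypothesis.ValiantsHypothesis.Theorems.LacunarySymmetroidMatrixDescartesRegimeWindowsToolkit

/-!
# `MatrixDescartes` (stmt-ValiantsHypothesis-18050) — the DOMINATED WINDOW lemma: Loewner monotonicity of `F/x^{d_π}`
# on a scale window from dominance at its two endpoints (the engine of the Cameron–Psarrakos-type laws `n·α`)

HONEST FRAMING.  Cell `pub-symmetroid`, seat `val-sym-mdr-p2` (gen 4); helper file `--supports` the crux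
`Theses.LacunarySymmetroid.MatrixDescartes`.  A root-counting ENGINE lemma (one window of the regime-window principle,
`…RegimeWindows*`); nothing here bears on the crux in general, on `stub_twoSided`, on `DoorA26` / `DoorA34`, or on
`VP ≠ VNP`.

THE LEMMA (`dominatedWindow_mono`).  `F = ∑ₗ X^{dₗ} Sₗ`, real symmetric letters at strictly increasing exponents, a
PIVOT index `π` (its letter `S_π` ARBITRARY), and every other letter semidefinite with a prescribed sign `pos l`
(`Sₗ ⪰ 0`) or `¬pos l` (`Sₗ ⪯ 0`).  For the family `u ↦ F(u)/u^{d_π}` the GOOD letters are the NSD ones below the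
pivot and the PSD ones above it (their terms are Loewner non-decreasing); the BAD ones are the PSD letters below and
the NSD letters above.  Suppose the bad letters below all lie below an NSD letter `μ' < π` which dominates them at the
LEFT endpoint `a`:  `(d_π − d_μ')·(−S_μ') ⪰ ∑_{bad below} (d_π − d_l)·(a⁻¹)^{d_μ' − d_l}·S_l`, and the bad letters above
all lie above a PSD letter `μ > π` which dominates them at the RIGHT endpoint `b`:
`(d_μ − d_π)·S_μ ⪰ ∑_{bad above} (d_l − d_π)·b^{d_l − d_μ}·(−S_l)`.  Then `F/x^{d_π}` is Loewner non-decreasing on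
`[a, b]` (`0 < a`).  With the toolkit (`posRoots_Ico_le_of_mono` etc.) each such window carries at most `card ι`
positive zeros of `det F`; a semidefinite sign word with `α` alternations whose `α` sign boundaries dominate a covering
family of windows therefore has `Z₊ ≤ α·card ι` — the Cameron–Psarrakos count [CameronPsarrakos2019, (6)] under
dominance (kernel: `α = 1` `oneAlternation`, `α = 2` `dominantMiddle`; this file supplies the window step for every
`α`).  Half-lines: with no bad letters above, the right endpoint `b` enters only an empty sum (take `b := t`), so
the lemma gives monotonicity on `[a, ∞)`; symmetrically with no bad letters below (take `a := s`) on `(0, b]`; the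
non-increasing direction is the lemma for `−F` (signs swapped).
[folklore] Elementary; Mathlib + tree lemmas (`DominantMiddle.pow_sub_pow_window`, `coeff_above/below`,
`quadForm_diff/finsum`, `LoewnerSector.smul_family_isSymm`); axioms `propext`, `Classical.choice`, `Quot.sound`.
-/

-- layout Summits/ValiantsHypothesis/ValiantsHypothesis forces the duplicated namespace component
set_option linter.dupNamespace false

namespace Summit.ValiantsHypothesis.ValiantsHypothesis.Theorems.LacunarySymmetroidMatrixDescartes

open Polynomial Matrix Finset
open scoped BigOperators

namespace DominatedWindow

variable {K : ℕ}

/-- **Scalar dominated window.**  Pivot `π`, signs `pos`, scalars `qₗ` with the prescribed signs off the pivot;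
bad-below letters (`l < π`, `pos l`) lie below the NSD letter `μ' < π` and are dominated by it at `a`; bad-above letters
(`π < l`, `¬pos l`) lie above the PSD letter `μ > π` and are dominated by it at `b`.  Then for `a ≤ s ≤ t ≤ b`
(`0 < a`): `∑ₗ (t^{dₗ}/t^{d_π} − s^{dₗ}/s^{d_π})·qₗ ≥ 0`. [folklore] -/
theorem scalar_nonneg (d : Fin K → ℕ) (hd : StrictMono d) (π μ μ' : Fin K) (hμ'π : μ' < π) (hπμ : π < μ)
    (pos : Fin K → Prop) [DecidablePred pos] (hμ'neg : ¬ pos μ') (hμpos : pos μ)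
    (q : Fin K → ℝ) (hsign : ∀ l, l ≠ π → (pos l → 0 ≤ q l) ∧ (¬ pos l → q l ≤ 0))
    (hbadB : ∀ l, l < π → pos l → l < μ') (hbadA : ∀ l, π < l → ¬ pos l → μ < l)
    (a b : ℝ) (ha : 0 < a)
    (hdomB : ∑ l ∈ univ.filter (fun l => l < π ∧ pos l), ((d π - d l : ℕ) : ℝ) * (a⁻¹) ^ (d μ' - d l) * q l
        ≤ ((d π - d μ' : ℕ) : ℝ) * (-q μ'))
    (hdomA : ∑ l ∈ univ.filter (fun l => π < l ∧ ¬ pos l), ((d l - d π : ℕ) : ℝ) * b ^ (d l - d μ) * (-q l)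
        ≤ ((d μ - d π : ℕ) : ℝ) * q μ)
    {s t : ℝ} (has : a ≤ s) (hst : s ≤ t) (htb : t ≤ b) :
    0 ≤ ∑ l, (t ^ d l * (t ^ d π)⁻¹ - s ^ d l * (s ^ d π)⁻¹) * q l := by
  have hs : 0 < s := ha.trans_le has
  have ht : 0 < t := hs.trans_le hst
  set f : Fin K → ℝ := fun l => (t ^ d l * (t ^ d π)⁻¹ - s ^ d l * (s ^ d π)⁻¹) * q l with hf
  -- classify the indices: BA (bad above), BB (bad below), and the rest (pivot + good letters)
  set BA := univ.filter (fun l : Fin K => π < l ∧ ¬ pos l) with hBA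
  set BB := univ.filter (fun l : Fin K => l < π ∧ pos l) with hBB
  -- (1) good terms and the pivot term are nonnegative
  have hgood : ∀ l, l ∉ BA → l ∉ BB → 0 ≤ f l := by
    intro l hlA hlB
    simp only [hf]
    rcases lt_trichotomy l π with hlt | heq | hgt
    · -- below the pivot and not bad: NSD, coefficient `(u^{d_π − d_l})⁻¹` non-increasing
      have hnp : ¬ pos l := fun hp => hlB (Finset.mem_filter.2 ⟨Finset.mem_univ _, hlt, hp⟩)
      have hle : d l ≤ d π := hd.monotone hlt.le
      rw [DominantMiddle.coeff_below ht.ne' hle, DominantMiddle.coeff_below hs.ne' hle]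
      exact mul_nonneg_of_nonpos_of_nonpos
        (sub_nonpos.2 (inv_anti₀ (pow_pos hs _) (pow_le_pow_left₀ hs.le hst _))) ((hsign l hlt.ne).2 hnp)
    · subst heq
      rw [mul_inv_cancel₀ (pow_ne_zero _ ht.ne'), mul_inv_cancel₀ (pow_ne_zero _ hs.ne'), sub_self, zero_mul]
    · -- above the pivot and not bad: PSD, coefficient `u^{d_l − d_π}` non-decreasing
      have hp : pos l := by
        by_contra hnp
        exact hlA (Finset.mem_filter.2 ⟨Finset.mem_univ _, hgt, hnp⟩)
      have hle : d π ≤ d l := hd.monotone hgt.le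
      rw [DominantMiddle.coeff_above ht.ne' hle, DominantMiddle.coeff_above hs.ne' hle]
      exact mul_nonneg (sub_nonneg.2 (pow_le_pow_left₀ hs.le hst _)) ((hsign l hgt.ne').1 hp)
  -- (2) the bad-above block is dominated by `μ`:  `γ_μ · (f μ + ∑_{BA} f) ≥ 0`
  have hdμ : d π < d μ := hd hπμ
  have hγμ : (0 : ℝ) < ((d μ - d π : ℕ) : ℝ) := by exact_mod_cast Nat.sub_pos_of_lt hdμ
  have hfμ : f μ = (t ^ (d μ - d π) - s ^ (d μ - d π)) * q μ := by
    simp only [hf]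
    rw [DominantMiddle.coeff_above ht.ne' hdμ.le, DominantMiddle.coeff_above hs.ne' hdμ.le]
  have hA_bound : ∀ l ∈ BA,
      -( ((d l - d π : ℕ) : ℝ) * b ^ (d l - d μ) * (t ^ (d μ - d π) - s ^ (d μ - d π)) * (-q l))
        ≤ ((d μ - d π : ℕ) : ℝ) * f l := by
    intro l hl
    obtain ⟨hπl, hnp⟩ := (Finset.mem_filter.1 hl).2
    have hμl : d μ < d l := hd (hbadA l hπl hnp)
    have hle : d π ≤ d l := (hdμ.trans hμl).le
    simp only [hf]
    rw [DominantMiddle.coeff_above ht.ne' hle, DominantMiddle.coeff_above hs.ne' hle]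
    have ek : d l - d π = (d μ - d π) + (d l - d μ) := by omega
    have hcmp := DominantMiddle.pow_sub_pow_window hs.le hst htb (d μ - d π) (d l - d μ) (Nat.sub_pos_of_lt hdμ)
    rw [← ek] at hcmp
    have ecast : ((d μ - d π : ℕ) : ℝ) + ((d l - d μ : ℕ) : ℝ) = ((d l - d π : ℕ) : ℝ) := by
      rw [← Nat.cast_add, ← ek]
    rw [ecast] at hcmp
    have hql : 0 ≤ -q l := neg_nonneg.2 ((hsign l hπl.ne').2 hnp)
    have := mul_le_mul_of_nonneg_right hcmp hql
    nlinarith [this]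
  have hA_sum : -((t ^ (d μ - d π) - s ^ (d μ - d π))
        * ∑ l ∈ BA, ((d l - d π : ℕ) : ℝ) * b ^ (d l - d μ) * (-q l))
      ≤ ((d μ - d π : ℕ) : ℝ) * ∑ l ∈ BA, f l := by
    rw [Finset.mul_sum, Finset.mul_sum, ← Finset.sum_neg_distrib]
    refine Finset.sum_le_sum fun l hl => ?_
    have hb' := hA_bound l hl
    have e : (t ^ (d μ - d π) - s ^ (d μ - d π)) * (((d l - d π : ℕ) : ℝ) * b ^ (d l - d μ) * (-q l))
        = ((d l - d π : ℕ) : ℝ) * b ^ (d l - d μ) * (t ^ (d μ - d π) - s ^ (d μ - d π)) * (-q l) := by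
      ring
    rw [e]
    exact hb'
  have htsA : 0 ≤ t ^ (d μ - d π) - s ^ (d μ - d π) := sub_nonneg.2 (pow_le_pow_left₀ hs.le hst _)
  have hdomA' := mul_le_mul_of_nonneg_left hdomA htsA
  have hkeyA : 0 ≤ ∑ l ∈ BA, f l + f μ := by
    have h0 : 0 ≤ ((d μ - d π : ℕ) : ℝ) * (∑ l ∈ BA, f l + f μ) := by
      rw [mul_add, hfμ]
      nlinarith [hA_sum, hdomA']
    exact nonneg_of_mul_nonneg_right h0 hγμ
  -- (3) the bad-below block is dominated by `μ'`:  `γ' · (f μ' + ∑_{BB} f) ≥ 0`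
  have hdμ' : d μ' < d π := hd hμ'π
  have hγ' : (0 : ℝ) < ((d π - d μ' : ℕ) : ℝ) := by exact_mod_cast Nat.sub_pos_of_lt hdμ'
  have hσ : 0 ≤ t⁻¹ := (inv_pos.2 ht).le
  have hσρ : t⁻¹ ≤ s⁻¹ := inv_anti₀ hs hst
  have hρa : s⁻¹ ≤ a⁻¹ := inv_anti₀ ha has
  have hfμ' : f μ' = ((s⁻¹) ^ (d π - d μ') - (t⁻¹) ^ (d π - d μ')) * (-q μ') := by
    simp only [hf]
    rw [DominantMiddle.coeff_below ht.ne' hdμ'.le, DominantMiddle.coeff_below hs.ne' hdμ'.le, ← inv_pow, ← inv_pow]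
    ring
  have hB_bound : ∀ l ∈ BB,
      -( ((d π - d l : ℕ) : ℝ) * (a⁻¹) ^ (d μ' - d l) * ((s⁻¹) ^ (d π - d μ') - (t⁻¹) ^ (d π - d μ')) * q l)
        ≤ ((d π - d μ' : ℕ) : ℝ) * f l := by
    intro l hl
    obtain ⟨hlπ, hp⟩ := (Finset.mem_filter.1 hl).2
    have hlμ : d l < d μ' := hd (hbadB l hlπ hp)
    have hle : d l ≤ d π := (hlμ.trans hdμ').le
    simp only [hf]
    rw [DominantMiddle.coeff_below ht.ne' hle, DominantMiddle.coeff_below hs.ne' hle, ← inv_pow, ← inv_pow]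
    have ek : d π - d l = (d π - d μ') + (d μ' - d l) := by omega
    have hcmp := DominantMiddle.pow_sub_pow_window hσ hσρ hρa (d π - d μ') (d μ' - d l)
      (Nat.sub_pos_of_lt hdμ')
    rw [← ek] at hcmp
    have ecast : ((d π - d μ' : ℕ) : ℝ) + ((d μ' - d l : ℕ) : ℝ) = ((d π - d l : ℕ) : ℝ) := by
      rw [← Nat.cast_add, ← ek]
    rw [ecast] at hcmp
    have := mul_le_mul_of_nonneg_right hcmp ((hsign l hlπ.ne).1 hp)
    nlinarith [this]
  have hB_sum : -(((s⁻¹) ^ (d π - d μ') - (t⁻¹) ^ (d π - d μ'))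
        * ∑ l ∈ BB, ((d π - d l : ℕ) : ℝ) * (a⁻¹) ^ (d μ' - d l) * q l)
      ≤ ((d π - d μ' : ℕ) : ℝ) * ∑ l ∈ BB, f l := by
    rw [Finset.mul_sum, Finset.mul_sum, ← Finset.sum_neg_distrib]
    refine Finset.sum_le_sum fun l hl => ?_
    have hb' := hB_bound l hl
    have e : ((s⁻¹) ^ (d π - d μ') - (t⁻¹) ^ (d π - d μ'))
          * (((d π - d l : ℕ) : ℝ) * (a⁻¹) ^ (d μ' - d l) * q l)
        = ((d π - d l : ℕ) : ℝ) * (a⁻¹) ^ (d μ' - d l)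
          * ((s⁻¹) ^ (d π - d μ') - (t⁻¹) ^ (d π - d μ')) * q l := by ring
    rw [e]
    exact hb'
  have htsB : 0 ≤ (s⁻¹) ^ (d π - d μ') - (t⁻¹) ^ (d π - d μ') :=
    sub_nonneg.2 (pow_le_pow_left₀ hσ hσρ _)
  have hdomB' := mul_le_mul_of_nonneg_left hdomB htsB
  have hkeyB : 0 ≤ ∑ l ∈ BB, f l + f μ' := by
    have h0 : 0 ≤ ((d π - d μ' : ℕ) : ℝ) * (∑ l ∈ BB, f l + f μ') := by
      rw [mul_add, hfμ']
      nlinarith [hB_sum, hdomB']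
    exact nonneg_of_mul_nonneg_right h0 hγ'
  -- (4) assemble: split `univ` into BA, BB, {μ}, {μ'}, rest
  have hμA : μ ∉ BA := fun h => (Finset.mem_filter.1 h).2.2 hμpos
  have hμB : μ ∉ BB := fun h => (lt_asymm (Finset.mem_filter.1 h).2.1) hπμ
  have hμ'A : μ' ∉ BA := fun h => (lt_asymm (Finset.mem_filter.1 h).2.1) hμ'π
  have hμ'B : μ' ∉ BB := fun h => hμ'neg (Finset.mem_filter.1 h).2.2
  have hμμ' : μ ≠ μ' := fun h => by rw [h] at hπμ; exact lt_asymm hπμ hμ'π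
  have hdisj : Disjoint BA BB := by
    rw [Finset.disjoint_filter]
    intro l _ h1 h2
    exact lt_asymm h1.1 h2.1
  -- the rest
  set R := ((BA ∪ BB)ᶜ.erase μ).erase μ' with hR
  have hrest : 0 ≤ ∑ l ∈ R, f l := by
    refine Finset.sum_nonneg fun l hl => ?_
    have hl1 := Finset.mem_of_mem_erase (Finset.mem_of_mem_erase hl)
    rw [Finset.mem_compl, Finset.mem_union, not_or] at hl1
    exact hgood l hl1.1 hl1.2
  have htot : ∑ l, f l = (∑ l ∈ BA, f l + f μ) + (∑ l ∈ BB, f l + f μ') + ∑ l ∈ R, f l := by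
    have h1 : ∑ l, f l = ∑ l ∈ BA ∪ BB, f l + ∑ l ∈ (BA ∪ BB)ᶜ, f l :=
      (Finset.sum_add_sum_compl (BA ∪ BB) f).symm
    have h2 : ∑ l ∈ BA ∪ BB, f l = ∑ l ∈ BA, f l + ∑ l ∈ BB, f l := Finset.sum_union hdisj
    have hμmem : μ ∈ (BA ∪ BB)ᶜ := by
      rw [Finset.mem_compl, Finset.mem_union, not_or]; exact ⟨hμA, hμB⟩
    have hμ'mem : μ' ∈ (BA ∪ BB)ᶜ.erase μ := by
      rw [Finset.mem_erase, Finset.mem_compl, Finset.mem_union, not_or]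
      exact ⟨hμμ'.symm, hμ'A, hμ'B⟩
    have h3 : ∑ l ∈ (BA ∪ BB)ᶜ, f l = f μ + (f μ' + ∑ l ∈ R, f l) := by
      rw [← Finset.add_sum_erase _ _ hμmem, ← Finset.add_sum_erase _ _ hμ'mem]
    rw [h1, h2, h3]
    ring
  show 0 ≤ ∑ l, f l
  rw [htot]
  linarith

end DominatedWindow

/-- **DOMINATED WINDOW ⇒ Loewner monotonicity.**  `F = ∑ₗ X^{dₗ} Sₗ` (real symmetric letters, strictly increasing
exponents), pivot index `π` (letter `S_π` arbitrary), every other letter semidefinite with sign `pos l` (`⪰ 0`) /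
`¬pos l` (`⪯ 0`); bad-below letters (`l < π`, PSD) below the NSD letter `μ' < π` dominating them at the left endpoint
`a > 0`; bad-above letters (`π < l`, NSD) above the PSD letter `μ > π` dominating them at the right endpoint `b`.  Then
`u ↦ F(u)/u^{d_π}` is Loewner non-decreasing on `[a, b]`. [folklore] -/
theorem dominatedWindow_mono {ι : Type} [Fintype ι] [DecidableEq ι] {K : ℕ} (d : Fin K → ℕ) (hd : StrictMono d)
    (S : Fin K → Matrix ι ι ℝ) (hS : ∀ l, (S l).IsSymm) (π μ μ' : Fin K) (hμ'π : μ' < π) (hπμ : π < μ)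
    (pos : Fin K → Prop) [DecidablePred pos] (hμ'neg : ¬ pos μ') (hμpos : pos μ)
    (hsign : ∀ l, l ≠ π → (pos l → (S l).PosSemidef) ∧ (¬ pos l → (-S l).PosSemidef))
    (hbadB : ∀ l, l < π → pos l → l < μ') (hbadA : ∀ l, π < l → ¬ pos l → μ < l)
    (a b : ℝ) (ha : 0 < a)
    (hdomB : ((((d π - d μ' : ℕ) : ℝ)) • (-S μ')
      - ∑ l ∈ univ.filter (fun l => l < π ∧ pos l), (((d π - d l : ℕ) : ℝ) * (a⁻¹) ^ (d μ' - d l)) • S l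
        ).PosSemidef)
    (hdomA : ((((d μ - d π : ℕ) : ℝ)) • S μ
      - ∑ l ∈ univ.filter (fun l => π < l ∧ ¬ pos l), (((d l - d π : ℕ) : ℝ) * b ^ (d l - d μ)) • (-S l)
        ).PosSemidef)
    (s t : ℝ) (has : a ≤ s) (hst : s ≤ t) (htb : t ≤ b) :
    (((t ^ d π)⁻¹ • ∑ l, (t ^ d l) • S l) - ((s ^ d π)⁻¹ • ∑ l, (s ^ d l) • S l)).PosSemidef := by
  have hsymm : (((t ^ d π)⁻¹ • ∑ l, (t ^ d l) • S l) - ((s ^ d π)⁻¹ • ∑ l, (s ^ d l) • S l)).IsHermitian := by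
    have h0 : (((t ^ d π)⁻¹ • ∑ l, (t ^ d l) • S l) - ((s ^ d π)⁻¹ • ∑ l, (s ^ d l) • S l)).IsSymm := by
      unfold Matrix.IsSymm
      rw [Matrix.transpose_sub, (LoewnerSector.smul_family_isSymm d S hS _ t).eq,
        (LoewnerSector.smul_family_isSymm d S hS _ s).eq]
    exact Matrix.isHermitian_iff_isSymm.2 h0
  refine Matrix.PosSemidef.of_dotProduct_mulVec_nonneg hsymm fun v => ?_
  rw [star_trivial, DominantMiddle.quadForm_diff]
  -- scalar data
  have hsq : ∀ l, l ≠ π → (pos l → 0 ≤ v ⬝ᵥ (S l *ᵥ v)) ∧ (¬ pos l → v ⬝ᵥ (S l *ᵥ v) ≤ 0) := by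
    intro l hl
    refine ⟨fun hp => ?_, fun hnp => ?_⟩
    · simpa only [star_trivial] using ((hsign l hl).1 hp).dotProduct_mulVec_nonneg v
    · have h0 := ((hsign l hl).2 hnp).dotProduct_mulVec_nonneg v
      rw [star_trivial, Matrix.neg_mulVec, dotProduct_neg] at h0
      linarith
  have hdB : ∑ l ∈ univ.filter (fun l => l < π ∧ pos l),
      ((d π - d l : ℕ) : ℝ) * (a⁻¹) ^ (d μ' - d l) * (v ⬝ᵥ (S l *ᵥ v))
        ≤ ((d π - d μ' : ℕ) : ℝ) * (-(v ⬝ᵥ (S μ' *ᵥ v))) := by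
    have h0 := hdomB.dotProduct_mulVec_nonneg v
    rw [star_trivial, Matrix.sub_mulVec, dotProduct_sub, Matrix.smul_mulVec, dotProduct_smul, smul_eq_mul,
      Matrix.neg_mulVec, dotProduct_neg, DominantMiddle.quadForm_finsum] at h0
    linarith
  have hdA : ∑ l ∈ univ.filter (fun l => π < l ∧ ¬ pos l),
      ((d l - d π : ℕ) : ℝ) * b ^ (d l - d μ) * (-(v ⬝ᵥ (S l *ᵥ v)))
        ≤ ((d μ - d π : ℕ) : ℝ) * (v ⬝ᵥ (S μ *ᵥ v)) := by
    have h0 := hdomA.dotProduct_mulVec_nonneg v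
    rw [star_trivial, Matrix.sub_mulVec, dotProduct_sub, Matrix.smul_mulVec, dotProduct_smul, smul_eq_mul,
      DominantMiddle.quadForm_finsum] at h0
    have e : ∀ l, (((d l - d π : ℕ) : ℝ) * b ^ (d l - d μ)) * (v ⬝ᵥ ((-S l) *ᵥ v))
        = ((d l - d π : ℕ) : ℝ) * b ^ (d l - d μ) * (-(v ⬝ᵥ (S l *ᵥ v))) := by
      intro l; rw [Matrix.neg_mulVec, dotProduct_neg]
    simp_rw [e] at h0
    linarith
  exact DominatedWindow.scalar_nonneg d hd π μ μ' hμ'π hπμ pos hμ'neg hμpos (fun l => v ⬝ᵥ (S l *ᵥ v)) hsq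
    hbadB hbadA a b ha hdB hdA has hst htb

end Summit.ValiantsHypothesis.ValiantsHypothesis.Theorems.LacunarySymmetroidMatrixDescartes
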